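import Literature.Analysis.FluidPDE.NSEssEndpointLR
import Literature.Analysis.FluidPDE.CKNEpsilonRegularityHolds
import Literature.Analysis.FluidPDE.NSGaldiEnergyEqualityHolds
import Literature.Analysis.FluidPDE.CheskidovShvydkoyRegularProofs
import HarnessLib

/-!
# The endpoint criterion `ess_endpoint`: the remaining core (three named facts)

Analysis/FluidPDE proof file (theorems only; no definition, no named fact) in the decomposition
of **ns.S08** `Literature.Analysis.FluidPDE.ess_endpoint` (Escauriaza–Seregin–Šverák 2003,
Thm. 1.3: a Leray–Hopf weak solution of the unforced Cauchy problem on `ℝ³ × [0, T)` lying in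
`L^∞(0, T; L³(ℝ³))` is smooth on the open strip and unique among Leray–Hopf solutions with the
same datum).

The accepted assembly `ess_endpoint_of_ESS_theory_LR` (`FluidPDE/NSEssEndpointLR`) proves
`ess_endpoint` from six named facts. Three of them are now theorems of the tree:

* `lemarieRieusset_epsilon_regularity_holds` (`FluidPDE/CKNEpsilonRegularityHolds`; Lemarié-Rieusset
  2016, Thm. 14.4 — the Caffarelli–Kohn–Nirenberg ε-regularity criterion, used at spatial
  infinity in place of ESS Lemma 2.2),
* `galdi_energy_equality_holds` (`FluidPDE/NSGaldiEnergyEqualityHolds`; Galdi 2019, Thm. 1.1 —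
  the energy equality for `L⁴(Q_T)` very weak solutions, which disposes of the degenerate,
  non-measurable datum admitted by the formal Leray–Hopf predicate),
* `ladyzhenskaya_prodi_serrin_holds` (`FluidPDE/CheskidovShvydkoyRegularProofs`; Prodi–Serrin–
  Ladyzhenskaya = ESS Thm. 1.2, the passage from (1.14) `u ∈ L₅(Q_T)` to smoothness).

This file plugs them in, so that the kernel certifies that the *whole* remaining trust base of
**ns.S08** is the ESS core proper:

1. `ess_local_holder` — ESS Thm. 1.4 (local Hölder regularity of `L_{3,∞}` suitable pairs on
   the unit cylinder: blow-up, backward uniqueness across a half-space Thm. 5.1, unique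
   continuation Thm. 4.1, the two Carleman inequalities of §6);
2. `ess_associated_pressure` — ESS (3.2)–(3.4) (the associated pressure
   `p = ℛᵢℛⱼ(uᵢuⱼ) ∈ L^∞(0,T; L^{3/2})` of a Leray–Hopf solution in `L^∞_t L³_x`, making
   `(u, p)` a distributional pair to which Thm. 1.4 applies after rescaling);
3. `ess_kato_L3_local` — ESS Thm. 7.4 / Remark 7.5 (Kato–Giga: the short-time Leray–Hopf
   solution from `a ∈ L₃ ∩ J̊` lies in `C([0,T⋆]; L³) ∩ L₅(Q_{T⋆}) ∩ L₄(Q_{T⋆})`, which gives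
   `u ∈ L₅` near `t = 0` and, by the proved weak–strong uniqueness, the uniqueness clause).

* `ess_sup_bound_of_core : ess_local_holder → ess_associated_pressure → ess_sup_bound`
  (ESS (3.5)–(3.6));
* `ess_L5_integrability_of_core : ess_local_holder → ess_associated_pressure →
  ess_kato_L3_local → ess_L5_integrability` (ESS (1.14));
* `ess_endpoint_of_core : ess_local_holder → ess_associated_pressure → ess_kato_L3_local →
  ess_endpoint` (ESS Thm. 1.3).

The discharge `ess_endpoint_holds` is then the one-line composition of `ess_endpoint_of_core`
with the discharges of the three facts, in a file downstream of theirs. Why no shorter trust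
base is available by re-decomposition (recorded for the reconciler): the uniqueness clause of
`ess_endpoint` starts at `t = 0` with a datum that is only in `L² ∩ L³`, where `L³` is critical —
every weak–strong mechanism needs a strong solution in a Serrin class `L^s_t L^q_x`,
`2/s + 3/q = 1`, `q > 3`, near `t = 0`, and Kato's weighted class `√t ‖u(t)‖_∞ ≤ C` misses every
such class logarithmically; this is exactly what Thm. 7.4 (Giga's `L₅(Q_T)` estimate) supplies,
so fact 3 cannot be dropped; fact 2 cannot be dropped because Thm. 1.4 is a statement about
velocity–pressure pairs; fact 1 is the theorem's substance. The alternative architecture of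
Lemarié-Rieusset 2016, Thm. 15.21 (the endpoint criterion from Seregin's theorem for mild
solutions, Thm. 15.5 = the tree's `seregin_L3_blowup_mild`) needs, besides that deeper fact,
the identification of Leray–Hopf and Kato solutions on the whole Kato lifespan, again through
Kato–Giga integrability.

## References

* L. Escauriaza, G. Seregin, V. Šverák, *`L_{3,∞}`-solutions of Navier–Stokes equations and
  backward uniqueness*, Uspekhi Mat. Nauk 58:2 (2003) 3–44 = Russ. Math. Surveys 58:2 (2003)
  211–250: Thm. 1.2, Thm. 1.3 ((1.13) ⇒ (1.14)), Thm. 1.4, Lemma 2.2, §3 (3.1)–(3.7), Thm. 4.1,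
  Thm. 5.1, Thm. 7.4 with Remark 7.5. [EscauriazaSereginSverak2003]
* P. G. Lemarié-Rieusset, *The Navier–Stokes Problem in the 21st Century*, CRC Press (2016),
  Thm. 14.4 (p. 505); §15.12, Thm. 15.21 (PDF p. 597) with Thm. 15.5. [LemarieRieusset2016]
* G. P. Galdi, *On the energy equality for distributional solutions to Navier–Stokes equations*,
  Proc. AMS 147 (2019), Thm. 1.1. [Galdi2018]
* J. C. Robinson, J. L. Rodrigo, W. Sadowski, *The three-dimensional Navier–Stokes equations*
  (CUP 2016), Thm. 8.17 (LPS), Thm. 16.4 and §16.4 (sketch of the ESS architecture).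
  [RobinsonRodrigoSadowski2016]
-/

noncomputable section

namespace Literature.Analysis.FluidPDE

/-- **ESS (3.5)–(3.6) from the two ESS-specific facts** (Escauriaza–Seregin–Šverák 2003, §3,
proof of Thm. 1.3, (3.5)–(3.6): a Leray–Hopf solution of the Cauchy problem with datum in `J̊` and
`u ∈ L_{3,∞}(Q_T)` is essentially bounded on `ℝ³ × (δ, T)` for every `δ > 0`). The accepted
`ess_sup_bound_of_LR` with the ε-regularity criterion supplied by the theorem
`lemarieRieusset_epsilon_regularity_holds` (Lemarié-Rieusset 2016, Thm. 14.4); what remains is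
ESS Thm. 1.4 (`ess_local_holder`) and the associated pressure (3.2)–(3.4)
(`ess_associated_pressure`). Real proof. [cite: EscauriazaSereginSverak2003, §3 (3.5)–(3.6)] -/
theorem ess_sup_bound_of_core (hLH : ess_local_holder) (hP : ess_associated_pressure) :
    ess_sup_bound :=
  ess_sup_bound_of_LR hLH lemarieRieusset_epsilon_regularity_holds hP

/-- **ESS Thm. 1.3, conclusion (1.14), from the three core facts** (Escauriaza–Seregin–Šverák
2003, §3, proof of Thm. 1.3: `u ∈ L₅(Q_T)` from (3.6)–(3.7) on `(δ, T)` and from Thm. 7.4 with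
weak–strong uniqueness on `(0, δ₀)`). The accepted `ess_L5_integrability_of_sup_bound` over
`ess_sup_bound_of_core`, the degenerate datum being handled by the theorem
`galdi_energy_equality_holds` (Galdi 2019, Thm. 1.1). Real proof. [cite: EscauriazaSereginSverak2003, Thm. 1.3 (1.14)] -/
theorem ess_L5_integrability_of_core (hLH : ess_local_holder) (hP : ess_associated_pressure)
    (hK : ess_kato_L3_local) : ess_L5_integrability :=
  ess_L5_integrability_of_sup_bound (ess_sup_bound_of_core hLH hP) hK galdi_energy_equality_holds

/-- **`ess_endpoint` (ns.S08) from the Escauriaza–Seregin–Šverák core: three named facts**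
(Escauriaza–Seregin–Šverák 2003, Thm. 1.3 with §3: "(1.14) and hence it is smooth and unique in
`Q_T`"). The endpoint criterion follows from ESS Thm. 1.4 (`ess_local_holder`), the associated
pressure (3.2)–(3.4) (`ess_associated_pressure`) and Kato's `L³` theory Thm. 7.4
(`ess_kato_L3_local`); the other three inputs of the accepted `ess_endpoint_of_ESS_theory_LR` are
the theorems `lemarieRieusset_epsilon_regularity_holds` (CKN ε-regularity, Lemarié-Rieusset 2016,
Thm. 14.4), `galdi_energy_equality_holds` (Galdi 2019, Thm. 1.1) and
`ladyzhenskaya_prodi_serrin_holds` (ESS Thm. 1.2 = Ladyzhenskaya–Prodi–Serrin). Real proof; the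
discharge `ess_endpoint_holds` is this theorem applied to the discharges of the three facts. [cite: EscauriazaSereginSverak2003, Thm. 1.3] -/
theorem ess_endpoint_of_core (hLH : ess_local_holder) (hP : ess_associated_pressure)
    (hK : ess_kato_L3_local) : ess_endpoint :=
  ess_endpoint_of_ESS_theory_LR hLH lemarieRieusset_epsilon_regularity_holds hP hK
    galdi_energy_equality_holds ladyzhenskaya_prodi_serrin_holds

end Literature.Analysis.FluidPDE

end
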